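import Literature.Probability.NegativeDependence.StronglyRayleighNegativeAssociation
import Mathlib.LinearAlgebra.Matrix.Charpoly.Coeff
import Mathlib.Analysis.Matrix.Hermitian
import Mathlib.LinearAlgebra.Matrix.ToLinearEquiv
import HarnessLib

/-!
# Determinantal measures are strongly Rayleigh, hence negatively associated
# (Borcea–Brändén–Liggett, §3.3: Proposition 3.5 and Theorem 3.4)

J. Borcea, P. Brändén, T. M. Liggett, *Negative dependence and the geometry of polynomials*, J. Amer. Math.
Soc. 22 (2009) 521–567 (arXiv:0707.2340, held `paper:arxiv-0707.2340`; numbering of the arXiv version), §3.3.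
Verbatim:

> In [Lyons] Lyons defined a determinantal probability measure on `2^[n]` to be a measure `μ ∈ 𝔓_n` such that
> there is an `n × n` matrix `A` so that for any subset `S` of `[n]` one has `μ({T : S ⊆ T}) = det(A[S])`,
> where as before `A[S]` denotes the principal submatrix of `A` whose rows and columns are indexed by `S`. […]
> Clearly, a positive semi-definite matrix is a contraction if and only if all its eigenvalues are in the
> interval `[0,1]`. Such matrices were called positive contractions in [Lyons].
> **Theorem 3.4.** Suppose that `μ` is a determinantal measure on `2^[n]` whose corresponding matrix is a
> positive contraction. Then `μ` is CNA+. […] Let us show that Theorem 3.4 actually follows from Theorem 4.9 of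
> §4.2 and the fact that determinantal measures induced by positive contractions are strongly Rayleigh:
> **Proposition 3.5.** Suppose that `μ` is a determinantal measure on `2^[n]` whose corresponding matrix is a
> positive contraction. Then `μ` is strongly Rayleigh.
> *Proof.* Since positive definite matrices are dense in the set of all positive semi-definite matrices, by
> Proposition 3.1 (3) it is enough to prove the statement for invertible positive contractions. Elementary
> computations show that `g_μ(z_1,…,z_n) = det(I - A + AZ) = det(A) · det(A⁻¹ - I + Z)`, where
> `Z = diag(z_1,…,z_n)`. Since `A` is an invertible positive contraction, `A⁻¹ - I` is positive semi-definite
> and `det(A) > 0`, so by Prop. 3.2 the polynomial `g_μ` is real stable. □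

## Transposition and route

* Weights `μ : Finset σ → ℝ` (`StableOrZero`, `ex`, `mass`, `pin`, `extField` from the sibling files);
  `IsDeterminantal μ A` is Lyons' definition with a complex kernel `A` (the sums `μ({T : S ⊆ T})` cast to `ℂ`).
* "Elementary computations": `Σ_T μ(T) Π_{i∈T}(1 + y_i) = Σ_S y^S μ({T ⊇ S}) = Σ_S y^S det A[S] = det(I + diag(y) A)`
  (multilinearity of `det` in the rows, Mathlib's `det_piecewise_one_eq_submatrix_det`), i.e.
  `g_μ(z) = det(I - A + diag(z) A)` (`IsDeterminantal.sum_mul_prod`; BBL write `AZ`, the transpose for symmetric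
  `A`, with the same determinant).
* Stability: instead of `det(A) det(A⁻¹ - I + Z)`, Prop. 3.2 and the density argument, a direct pairing: if
  `(I - A + ZA) v = 0` then pairing with `Av` gives `v*Av - ‖Av‖² + Σ_j z_j |(Av)_j|² = 0`; for Hermitian `A` the
  imaginary part is `Σ_j Im(z_j) |(Av)_j|² = 0`, so `Av = 0` and `v = 0`. Hence `g_μ(z) ≠ 0` on `ℋ^σ` for EVERY
  Hermitian kernel: the positive-contraction hypothesis is only what makes `μ` a positive measure (Lyons), and
  enters Theorem 3.4 below as the hypothesis `μ ≥ 0`.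
* Theorem 3.4 is then Theorem 4.9 (tree `StableOrZero.negAssoc_pin_extField`, file
  `StronglyRayleighNegativeAssociation.lean`) applied to `μ`.

## Contents

* §1 `IsDeterminantal μ A` (Lyons / BBL §3.3).
* §2 **`det_one_add_diagonal_mul`** (`det(I + diag(y)A) = Σ_S y^S det A[S]`, any commutative ring),
  `IsDeterminantal.sum_mul_prod_one_add`, **`IsDeterminantal.sum_mul_prod`** (`g_μ(z) = det(I - A + diag(z)A)`).
* §3 `mulVec_eq_zero_of_hermitian`, **`det_one_sub_add_diagonal_mul_ne_zero`** (`z ∈ ℋ^σ`).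
* §4 **`IsDeterminantal.stableOrZero`**, `IsDeterminantal.isRealStable_multiAffine` (Prop. 3.5),
  **`IsDeterminantal.negAssoc_pin_extField`**, `IsDeterminantal.negAssoc` (Thm. 3.4, CNA+ / NA for `μ ≥ 0`).

## References

* [BorceaBrandenLiggett2007] J. Borcea, P. Brändén, T. M. Liggett, Negative dependence and the geometry of
  polynomials, J. Amer. Math. Soc. 22 (2009), 521–567; arXiv:0707.2340 — §3.3.
* [Lyons2003] R. Lyons, Determinantal probability measures, Publ. Math. IHÉS 98 (2003), 167–212 (the definition
  and Thm. 3.4; cited through BBL).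
-/

noncomputable section

open Finset Matrix MvPolynomial
open scoped ComplexConjugate
open Literature.Combinatorics.Sahi2008
open Literature.Combinatorics.StablePolynomials

namespace Literature.Probability.NegativeDependence

variable {σ : Type*} [Fintype σ] [DecidableEq σ]

/-! ## §1 Determinantal measures (Lyons; BBL §3.3) -/

section Determinantal

/-- **Determinantal weight with kernel `A`** (Lyons, as recalled in BBL §3.3): "there is an `n × n` matrix `A` so
that for any subset `S` of `[n]` one has `μ({T : S ⊆ T}) = det(A[S])`, where `A[S]` denotes the principal submatrix
of `A` whose rows and columns are indexed by `S`" — for a real weight `μ` on `2^σ` and a complex kernel `A`.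
[cite: BorceaBrandenLiggett2007, §3.3 (definition of a determinantal probability measure)] -/
def IsDeterminantal (μ : Finset σ → ℝ) (A : Matrix σ σ ℂ) : Prop :=
  ∀ S : Finset σ, ((∑ T ∈ univ.filter (fun T => S ⊆ T), μ T : ℝ) : ℂ) =
    (A.submatrix (Subtype.val : S → σ) (Subtype.val : S → σ)).det

/-- Unfolding `IsDeterminantal`. [cite: BorceaBrandenLiggett2007, §3.3] -/
theorem isDeterminantal_iff (μ : Finset σ → ℝ) (A : Matrix σ σ ℂ) :
    IsDeterminantal μ A ↔ ∀ S : Finset σ, ((∑ T ∈ univ.filter (fun T => S ⊆ T), μ T : ℝ) : ℂ) =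
      (A.submatrix (Subtype.val : S → σ) (Subtype.val : S → σ)).det := Iff.rfl

end Determinantal

/-! ## §2 The principal-minor expansion `det(I + D_y A) = Σ_S y^S det A[S]` -/

section MinorExpansion

variable {R : Type*} [CommRing R]

/-- **`det(I + diag(y) A) = Σ_S (Π_{i∈S} y_i) det A[S]`** (multilinearity of `det` in the rows).
[cite: BorceaBrandenLiggett2007, §3.3 proof of Prop. 3.5 ("Elementary computations show that
`g_μ(z) = det(I - A + AZ)`")] -/
theorem det_one_add_diagonal_mul (y : σ → R) (A : Matrix σ σ R) :
    (1 + diagonal y * A).det = ∑ S : Finset σ, (∏ i ∈ S, y i) *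
      (A.submatrix (Subtype.val : S → σ) (Subtype.val : S → σ)).det := by
  have hrows : (1 + diagonal y * A : Matrix σ σ R) =
      (fun i => (diagonal y * A) i) + fun i => (1 : Matrix σ σ R) i := by
    ext i j
    simp [add_comm]
  rw [det, hrows, AlternatingMap.map_add_univ]
  refine Finset.sum_congr rfl fun S _ => ?_
  -- the piecewise row family is the row-scaled matrix `c_i · (S.piecewise A 1)_i`, `c_i = y_i` on `S`, `1` off `S`
  have hpw : (S.piecewise (fun i => (diagonal y * A) i) fun i => (1 : Matrix σ σ R) i) =
      of fun i j => (if i ∈ S then y i else 1) * (of (S.piecewise A.row (1 : Matrix σ σ R).row)) i j := by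
    ext i j
    by_cases hi : i ∈ S
    · simp [Finset.piecewise, hi, diagonal_mul, Matrix.row]
    · simp [Finset.piecewise, hi, Matrix.row]
  rw [hpw]
  change det _ = _
  rw [det_mul_column, det_piecewise_one_eq_submatrix_det, Finset.prod_ite, Finset.prod_const_one, mul_one,
    Finset.filter_mem_eq_inter, Finset.univ_inter]

omit [Fintype σ] in
/-- `Π_{i ∈ T} (1 + y_i) = Σ_{S ⊆ T} y^S`. [folklore] -/
private theorem prod_one_add_eq_sum_powerset (y : σ → R) (T : Finset σ) :
    ∏ i ∈ T, (1 + y i) = ∑ S ∈ T.powerset, ∏ i ∈ S, y i := by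
  rw [Finset.prod_congr rfl fun i _ => add_comm (1 : R) (y i), Finset.prod_add]
  refine Finset.sum_congr rfl fun S _ => ?_
  rw [Finset.prod_const_one, mul_one]

/-- **The generating polynomial of a determinantal weight**: `Σ_T μ(T) Π_{i∈T}(1 + y_i) = det(I + diag(y) A)`,
i.e. `g_μ(z) = det(I - A + diag(z) A)` at `z = 1 + y` ("`g_μ(z) = det(I - A + AZ)`"; for symmetric `A` the two
agree, in general they are transposes with equal determinant … here we keep `diag(z)·A`).
[cite: BorceaBrandenLiggett2007, §3.3 proof of Prop. 3.5] -/
theorem IsDeterminantal.sum_mul_prod_one_add {μ : Finset σ → ℝ} {A : Matrix σ σ ℂ} (h : IsDeterminantal μ A)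
    (y : σ → ℂ) : (∑ T : Finset σ, (μ T : ℂ) * ∏ i ∈ T, (1 + y i)) = (1 + diagonal y * A).det := by
  rw [det_one_add_diagonal_mul]
  simp_rw [prod_one_add_eq_sum_powerset, Finset.mul_sum]
  -- swap the sums: `Σ_T Σ_{S ⊆ T} μ_T y^S = Σ_S y^S Σ_{T ⊇ S} μ_T`
  rw [Finset.sum_comm' (t' := univ) (s' := fun S => univ.filter fun T => S ⊆ T)
    (fun T S => by simp [Finset.mem_powerset])]
  refine Finset.sum_congr rfl fun S _ => ?_
  rw [← h S, Complex.ofReal_sum, Finset.mul_sum]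
  exact Finset.sum_congr rfl fun T _ => mul_comm _ _

/-- The same at `z = 1 + y`: `Σ_T μ(T) z^T = det(I - A + diag(z) A)`. [cite: BorceaBrandenLiggett2007, §3.3 proof
of Prop. 3.5 ("`g_μ(z_1,…,z_n) = det(I - A + AZ)`")] -/
theorem IsDeterminantal.sum_mul_prod {μ : Finset σ → ℝ} {A : Matrix σ σ ℂ} (h : IsDeterminantal μ A)
    (z : σ → ℂ) : (∑ T : Finset σ, (μ T : ℂ) * ∏ i ∈ T, z i) = (1 - A + diagonal z * A).det := by
  have key := h.sum_mul_prod_one_add (fun i => z i - 1)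
  simp only [add_sub_cancel] at key
  rw [key]
  congr 1
  have hd : diagonal (fun i => z i - 1) = diagonal z - 1 := by
    rw [← diagonal_one, ← diagonal_sub]
  rw [hd, sub_mul, one_mul]
  abel

end MinorExpansion

/-! ## §3 `det(I - A + diag(z) A) ≠ 0` on `ℋ^σ` for Hermitian `A` -/

section Stability

/-- **The kernel argument.** For Hermitian `A` and `z ∈ ℋ^σ`, `I + (diag(z) - I) A` is injective: if
`v + (Z - I) A v = 0` then pairing with `Av` gives `v*Av - ‖Av‖² + Σ_j z_j |(Av)_j|² = 0`, whose imaginary part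
`Σ_j Im(z_j) |(Av)_j|²` vanishes only if `Av = 0`, and then `v = 0`. (BBL: "`det(A) · det(A⁻¹ - I + Z)` … by
Proposition 3.2 the polynomial `g_μ` is real stable", for invertible positive contractions plus density; the
pairing argument needs neither invertibility nor the contraction property.) [cite: BorceaBrandenLiggett2007, §3.3
proof of Prop. 3.5] -/
theorem mulVec_eq_zero_of_hermitian {A : Matrix σ σ ℂ} (hA : A.IsHermitian) {z : σ → ℂ} (hz : ∀ i, 0 < (z i).im)
    {v : σ → ℂ} (hv : (1 - A + diagonal z * A) *ᵥ v = 0) : v = 0 := by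
  -- `v - Av + Z(Av) = 0`
  have hv' : v - A *ᵥ v + diagonal z *ᵥ (A *ᵥ v) = 0 := by
    rw [add_mulVec, sub_mulVec, one_mulVec, ← mulVec_mulVec] at hv
    exact hv
  set u := A *ᵥ v with hu
  -- pair with `u = Av`
  have hpair : star u ⬝ᵥ v - star u ⬝ᵥ u + star u ⬝ᵥ (diagonal z *ᵥ u) = 0 := by
    have := congrArg (fun w => star u ⬝ᵥ w) hv'
    simpa only [dotProduct_add, dotProduct_sub, dotProduct_zero] using this
  -- the three terms: `u* v = conj(v* A v)` is real, `u* u` is real, `u* Z u = Σ z_j |u_j|²`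
  have h1 : (star u ⬝ᵥ v).im = 0 := by
    have hreal : (star v ⬝ᵥ (A *ᵥ v)).im = 0 := hA.im_star_dotProduct_mulVec_self v
    have hconj : star u ⬝ᵥ v = conj (star v ⬝ᵥ u) := by
      rw [hu]
      simp only [dotProduct, map_sum, map_mul, Pi.star_apply, Complex.star_def, Complex.conj_conj]
      exact Finset.sum_congr rfl fun i _ => mul_comm _ _
    rw [hconj, Complex.conj_im, hreal, neg_zero]
  have h2 : (star u ⬝ᵥ u).im = 0 := by
    rw [dotProduct, Complex.im_sum]
    refine Finset.sum_eq_zero fun i _ => ?_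
    rw [Pi.star_apply, Complex.star_def, Complex.mul_im, Complex.conj_re, Complex.conj_im]
    ring
  have h3 : (star u ⬝ᵥ (diagonal z *ᵥ u)).im = ∑ i, (z i).im * Complex.normSq (u i) := by
    rw [dotProduct, Complex.im_sum]
    refine Finset.sum_congr rfl fun i _ => ?_
    rw [mulVec_diagonal, Pi.star_apply, Complex.star_def, show (starRingEnd ℂ) (u i) * (z i * u i) =
      z i * ((starRingEnd ℂ) (u i) * u i) by ring, Complex.mul_im, ← Complex.normSq_eq_conj_mul_self]
    simp
  have him := congrArg Complex.im hpair
  rw [Complex.add_im, Complex.sub_im, h1, h2, h3, sub_zero, zero_add, Complex.zero_im] at him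
  have hu0 : ∀ i, u i = 0 := fun i => by
    have := (Finset.sum_eq_zero_iff_of_nonneg fun i _ => mul_nonneg (hz i).le (Complex.normSq_nonneg _)).1 him i
      (Finset.mem_univ i)
    exact Complex.normSq_eq_zero.1 ((mul_eq_zero.1 this).resolve_left (hz i).ne')
  have hu0' : u = 0 := funext hu0
  rw [hu0', mulVec_zero, sub_zero, add_zero] at hv'
  exact hv'

/-- **`det(I - A + diag(z) A) ≠ 0` for `z ∈ ℋ^σ`** and Hermitian `A`. [cite: BorceaBrandenLiggett2007, §3.3 proof
of Prop. 3.5] -/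
theorem det_one_sub_add_diagonal_mul_ne_zero {A : Matrix σ σ ℂ} (hA : A.IsHermitian) {z : σ → ℂ}
    (hz : ∀ i, 0 < (z i).im) : (1 - A + diagonal z * A).det ≠ 0 := by
  intro h0
  obtain ⟨v, hv0, hv⟩ := Matrix.exists_mulVec_eq_zero_iff.2 h0
  exact hv0 (mulVec_eq_zero_of_hermitian hA hz hv)

end Stability

/-! ## §4 Proposition 3.5 and Theorem 3.4 -/

section Prop35

/-- **Borcea–Brändén–Liggett, Proposition 3.5.** "Suppose that `μ` is a determinantal measure on `2^[n]` whose
corresponding matrix is a positive contraction. Then `μ` is strongly Rayleigh." Here: every real weight that is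
determinantal for a Hermitian kernel `A` has a stable generating polynomial (never zero: `g_μ(z) = det(I - A +
diag(z) A)`); the contraction hypothesis `0 ≤ A ≤ I` is what makes `μ` a (positive) probability measure and is not
needed for the stability. [cite: BorceaBrandenLiggett2007, §3.3 Prop. 3.5] -/
theorem IsDeterminantal.stableOrZero {μ : Finset σ → ℝ} {A : Matrix σ σ ℂ} (h : IsDeterminantal μ A)
    (hA : A.IsHermitian) : StableOrZero μ :=
  Or.inr fun z hz => by
    rw [h.sum_mul_prod z]
    exact det_one_sub_add_diagonal_mul_ne_zero hA hz

/-- Prop. 3.5 in the `IsRealStable` vocabulary: `g_μ = Σ_S μ(S) z^S` is real stable. [cite: BorceaBrandenLiggett2007,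
§3.3 Prop. 3.5] -/
theorem IsDeterminantal.isRealStable_multiAffine {μ : Finset σ → ℝ} {A : Matrix σ σ ℂ} (h : IsDeterminantal μ A)
    (hA : A.IsHermitian) : IsRealStable (multiAffine μ) := by
  classical
  rw [isRealStable_multiAffine_iff]
  intro z hz
  rw [h.sum_mul_prod z]
  exact det_one_sub_add_diagonal_mul_ne_zero hA hz

/-- **Borcea–Brändén–Liggett, Theorem 3.4 (Lyons).** "Suppose that `μ` is a determinantal measure on `2^[n]` whose
corresponding matrix is a positive contraction. Then `μ` is CNA+" — derived as BBL do from Prop. 3.5 and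
Theorem 4.9 (tree `StableOrZero.negAssoc_pin_extField`): for a nonnegative determinantal weight with Hermitian
kernel, every external field (`a ≥ 0`) and conditioning of `μ` is negatively associated.
[cite: BorceaBrandenLiggett2007, §3.3 Thm. 3.4 (via Prop. 3.5 and Thm. 4.9)] -/
theorem IsDeterminantal.negAssoc_pin_extField {μ : Finset σ → ℝ} {A : Matrix σ σ ℂ} (h : IsDeterminantal μ A)
    (hA : A.IsHermitian) (h0 : ∀ S, 0 ≤ μ S) {a : σ → ℝ} (ha : ∀ i, 0 ≤ a i) (I O : Finset σ)
    {F G : Finset σ → ℝ} (hF : Monotone F) (hG : Monotone G) {E₁ E₂ : Finset σ} (hFE : DeterminedBy F E₁)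
    (hGE : DeterminedBy G E₂) (hdisj : Disjoint E₁ E₂) :
    ex (pin I O (extField a μ)) (F * G) * mass (pin I O (extField a μ)) ≤
      ex (pin I O (extField a μ)) F * ex (pin I O (extField a μ)) G :=
  (h.stableOrZero hA).negAssoc_pin_extField h0 ha I O hF hG hFE hGE hdisj

/-- Theorem 3.4, plain negative association: `E[FG] μ(Ω) ≤ E[F] E[G]` for increasing `F, G` depending on disjoint
coordinate sets. [cite: BorceaBrandenLiggett2007, §3.3 Thm. 3.4] -/
theorem IsDeterminantal.negAssoc {μ : Finset σ → ℝ} {A : Matrix σ σ ℂ} (h : IsDeterminantal μ A)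
    (hA : A.IsHermitian) (h0 : ∀ S, 0 ≤ μ S) {F G : Finset σ → ℝ} (hF : Monotone F) (hG : Monotone G)
    {E₁ E₂ : Finset σ} (hFE : DeterminedBy F E₁) (hGE : DeterminedBy G E₂) (hdisj : Disjoint E₁ E₂) :
    ex μ (F * G) * mass μ ≤ ex μ F * ex μ G :=
  (h.stableOrZero hA).negAssoc h0 hF hG hFE hGE hdisj

end Prop35

end Literature.Probability.NegativeDependence

end
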